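import Literature.Computability.QuantumComplexity.BQPProofs
import Literature.Computability.QuantumComplexity.ReversibleCliffordT
import Literature.Computability.QuantumComplexity.HybridArgument
import HarnessLib

/-!
# Hadamard sandwiches: block encodings by sign averaging over a uniform register

Topic `Literature/Computability/QuantumComplexity`; infrastructure for the discharge of
`ajl_jonesApproxProblem_mem_PromiseBQP` (`JonesInBQP.lean`). The irrational gates of the
Aharonov–Jones–Landau algorithm will be realised over Clifford+`T` as follows: a register of `a`
ancilla wires `ws` is put into the uniform superposition by a layer of Hadamard gates, an *exact*
(Clifford+`T`, classically controlled) operator `M` is applied, and the Hadamard layer is undone.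
On inputs and outputs whose ancilla wires read `0`, the resulting operator `H^{ws} M H^{ws}` has the
**averaged** matrix elements `2^{-a} Σ_{y' ∼ x} Σ_{y ∼ z} M_{y' y}` (sums over the labels agreeing with
`x`, `z` off `ws`) — the "linear combination of unitaries"/block-encoding mechanism of Childs–Wiebe and
Berry–Childs–Cleve–Kothari–Somma (2014, §3: the segment operator is a PREPARE–SELECT–PREPARE†
sandwich whose `|0⟩`-block is the target divided by a normalisation), here with the uniform
PREPARE `H^{⊗a}` so that everything stays inside Clifford+`T`. When `M` is a signed/phased
permutation given by an *integer* predicate, the block entries are dyadic averages of signs; one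
round of oblivious amplitude amplification (`ObliviousAmplification.lean`) then turns a block equal to
`V/2 + O(2^{-a})` into an implementation of `V`.

Contents (all proved):

* `EqOff ws x y` (labels agreeing off the LIST of wires `ws`; the embedding-indexed analogue is
  `AgreeOff` of `RestBlockStates.lean`), the fibres `fibreOff ws x` and their
  cardinality `2^{|ws|}` (`card_fibreOff`);
* `hadLayer ws` = the matrix of the gate list `ws.map hOn`, `hadLayerRev ws` = that of the reversed
  list; `hadLayer_apply_of_zero` (columns at labels vanishing on `ws`: the uniform amplitude
  `(1/√2)^{|ws|}` on the fibre, from `hadamards_mulVec_basisState` of `BQPProofs.lean`);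
  `hadLayerRev_eq_transpose` (each placed `H` is symmetric), hence the rows of the reversed layer;
* **the sandwich formula** `hadSandwich_apply`: for `x`, `z` vanishing on `ws`,
  `(hadLayerRev ws * M * hadLayer ws) x z = 2^{-|ws|} Σ_{y' ∈ fibre x} Σ_{y ∈ fibre z} M y' y`;
* the signed-permutation middle operator `CNOT_{c→t} · phaseDiag g` (`phaseDiag g = diag(i^{g})`) and
  **the block formula** `hadSandwich_cnot_phase_apply`: with the column wire `c ∈ ws` and the target
  `t ∉ ws`, the block is `2 × 2` in the bit `t` with entries `2^{-|ws|} Σ_{y ∼ z, y c = x t ⊕ z t} i^{g y}`;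
* **a norm bound for wire-local operators** `l2Norm_mulVec_le_of_local`: if `K x z = 0` unless `x`, `z`
  agree off a set `T` of `m` wires and all entries have modulus `≤ η`, then `‖Kψ‖₂ ≤ 2^m η ‖ψ‖₂`
  (Cauchy–Schwarz on the fibres) — the estimate that converts entrywise rounding errors of a block
  into the operator-norm hypothesis of oblivious amplitude amplification.

## References

* D. W. Berry, A. M. Childs, R. Cleve, R. Kothari, R. D. Somma, *Exponential improvement in precision
  for simulating sparse Hamiltonians*, STOC 2014 (arXiv:1312.1414), §3 (segments as
  `PREPARE · SELECT · PREPARE†` with a `|0^μ⟩`-block, Lemma 3.1) [BerryEtAl2014].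
* M. A. Nielsen, I. L. Chuang, *Quantum Computation and Quantum Information*, CUP 2010, §1.4.4
  (`H^{⊗n}`), §4.3 [NielsenChuang2010].
-/

noncomputable section

namespace Literature.Computability.QuantumComplexity

open Matrix Finset

variable {N : ℕ}

/-! ### Agreement off a set of wires, fibres -/

/-- The labels `x`, `y` agree off the wires `ws`. [folklore] -/
def EqOff (ws : List (Fin N)) (x y : Cryptography.QReg N) : Prop := ∀ j, j ∉ ws → x j = y j

/-- Agreement off `ws` is decidable. [folklore] -/
instance (ws : List (Fin N)) (x y : Cryptography.QReg N) : Decidable (EqOff ws x y) := by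
  unfold EqOff; infer_instance

/-- Agreement is reflexive. [folklore] -/
theorem eqOff_refl {ws : List (Fin N)} (x : Cryptography.QReg N) : EqOff ws x x := fun _ _ => Eq.refl _

/-- Agreement is symmetric. [folklore] -/
theorem EqOff.symm {ws : List (Fin N)} {x y : Cryptography.QReg N} (h : EqOff ws x y) : EqOff ws y x :=
  fun j hj => (h j hj).symm

/-- Agreement is transitive. [folklore] -/
theorem EqOff.trans {ws : List (Fin N)} {x y z : Cryptography.QReg N} (h₁ : EqOff ws x y) (h₂ : EqOff ws y z) :
    EqOff ws x z := fun j hj => (h₁ j hj).trans (h₂ j hj)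

/-- Symmetric form of the agreement condition. [folklore] -/
theorem eqOff_comm {ws : List (Fin N)} {x y : Cryptography.QReg N} : EqOff ws x y ↔ EqOff ws y x :=
  ⟨EqOff.symm, EqOff.symm⟩

/-- The fibre of `x`: all labels agreeing with `x` off `ws`. [folklore] -/
def fibreOff (ws : List (Fin N)) (x : Cryptography.QReg N) : Finset (Cryptography.QReg N) :=
  Finset.univ.filter fun y => EqOff ws y x

/-- Membership in a fibre. [folklore] -/
@[simp] theorem mem_fibreOff {ws : List (Fin N)} {x y : Cryptography.QReg N} : y ∈ fibreOff ws x ↔ EqOff ws y x := by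
  simp [fibreOff]

/-- Off one more wire `i ∉ ws`, agreement with `x` splits according to the bit on `i`. [folklore] -/
theorem eqOff_cons_iff {ws : List (Fin N)} {i : Fin N} {x y : Cryptography.QReg N} :
    EqOff (i :: ws) y x ↔ EqOff ws y (Function.update x i (y i)) := by
  constructor
  · intro h j hj
    by_cases hji : j = i
    · subst hji; simp
    · rw [Function.update_of_ne hji]; exact h j (by simp [hji, hj])
  · intro h j hj
    simp only [List.mem_cons, not_or] at hj
    have := h j hj.2
    rwa [Function.update_of_ne hj.1] at this

/-- **A fibre off `ws` has `2^{|ws|}` elements** (for distinct wires). [folklore] -/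
theorem card_fibreOff {ws : List (Fin N)} (hws : ws.Nodup) (x : Cryptography.QReg N) :
    (fibreOff ws x).card = 2 ^ ws.length := by
  induction ws generalizing x with
  | nil =>
    have : fibreOff ([] : List (Fin N)) x = {x} := by
      ext y
      simp only [mem_fibreOff, EqOff, List.not_mem_nil, not_false_eq_true, forall_const, Finset.mem_singleton]
      exact ⟨fun h => funext h, fun h => by subst h; exact fun _ => rfl⟩
    rw [this, Finset.card_singleton, List.length_nil, pow_zero]
  | cons i ws ih =>
    have hi : i ∉ ws := (List.nodup_cons.1 hws).1
    have hsplit : fibreOff (i :: ws) x =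
        (fibreOff ws (Function.update x i false)).disjUnion (fibreOff ws (Function.update x i true)) (by
          rw [Finset.disjoint_left]
          intro y h1 h2
          rw [mem_fibreOff] at h1 h2
          have e1 := h1 i hi
          have e2 := h2 i hi
          simp at e1 e2
          rw [e1] at e2
          exact Bool.false_ne_true e2) := by
      ext y
      rw [Finset.mem_disjUnion, mem_fibreOff, mem_fibreOff, mem_fibreOff, eqOff_cons_iff]
      constructor
      · intro h
        cases hyi : y i
        · left; rwa [hyi] at h
        · right; rwa [hyi] at h
      · rintro (h | h)
        · have e := h i hi
          rw [Function.update_self] at e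
          rwa [e]
        · have e := h i hi
          rw [Function.update_self] at e
          rwa [e]
    rw [hsplit, Finset.card_disjUnion, ih (List.nodup_cons.1 hws).2, ih (List.nodup_cons.1 hws).2, List.length_cons,
      pow_succ]
    ring

/-! ### Hadamard layers as matrices -/

/-- The matrix of the Hadamard layer `ws.map hOn` (one `H` on each wire of `ws`, applied in order).
[cite: NielsenChuang2010, §1.4.4] -/
def hadLayer (ws : List (Fin N)) : Matrix (Cryptography.QReg N) (Cryptography.QReg N) ℂ :=
  (⟨ws.map hOn⟩ : Cryptography.QCircuit Cryptography.cliffordT N).toMatrix 0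

/-- The matrix of the reversed Hadamard layer `(ws.map hOn).reverse` (the same gates undone in the
opposite order). [cite: NielsenChuang2010, §1.4.4] -/
def hadLayerRev (ws : List (Fin N)) : Matrix (Cryptography.QReg N) (Cryptography.QReg N) ℂ :=
  (⟨(ws.map hOn).reverse⟩ : Cryptography.QCircuit Cryptography.cliffordT N).toMatrix 0

/-- **Columns of the Hadamard layer at labels vanishing on `ws`**: the uniform amplitude
`(1/√2)^{|ws|}` on the fibre and `0` elsewhere. [cite: NielsenChuang2010, §1.4.4] -/
theorem hadLayer_apply_of_zero {ws : List (Fin N)} (hws : ws.Nodup) {z : Cryptography.QReg N}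
    (hz : ∀ i ∈ ws, z i = false) (y : Cryptography.QReg N) :
    hadLayer ws y z = if EqOff ws y z then invSqrt2 ^ ws.length else 0 := by
  have h := hadamards_mulVec_basisState ws hws z hz
  rw [mulVec_basisState] at h
  exact congrFun h y

/-- Transposition commutes with gate placement. [cite: NielsenChuang2010, §4.3] -/
theorem placeGate_transpose {k : ℕ} (e : Fin k ↪ Fin N) (U : Matrix (Cryptography.QReg k) (Cryptography.QReg k) ℂ) :
    (Cryptography.placeGate e U)ᵀ = Cryptography.placeGate e Uᵀ := by
  ext x y
  rw [Matrix.transpose_apply, Cryptography.placeGate_apply, Cryptography.placeGate_apply, Matrix.transpose_apply]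
  by_cases h : ∀ i, i ∉ Set.range e → x i = y i
  · rw [if_pos h, if_pos fun i hi => (h i hi).symm]
  · rw [if_neg h, if_neg fun h' => h fun i hi => (h' i hi).symm]

/-- The Hadamard matrix is symmetric. [cite: NielsenChuang2010, §1.3.1] -/
theorem hGate_transpose : Cryptography.hGateᵀ = Cryptography.hGate := by
  ext a b
  simp only [Matrix.transpose_apply, Cryptography.hGate, Matrix.of_apply]
  cases a 0 <;> cases b 0 <;> simp

/-- A placed Hadamard gate is symmetric. [cite: NielsenChuang2010, §1.3.1] -/
theorem hOn_toMatrix_transpose (i : Fin N) : ((hOn i).toMatrix 0)ᵀ = (hOn i).toMatrix 0 := by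
  rw [hOn_toMatrix, placeGate_transpose, hGate_transpose]

/-- **The reversed Hadamard layer is the transpose of the layer** (each factor is symmetric and
transposition reverses products). [folklore] -/
theorem hadLayerRev_eq_transpose (ws : List (Fin N)) : hadLayerRev ws = (hadLayer ws)ᵀ := by
  rw [hadLayer, hadLayerRev, Cryptography.QCircuit.toMatrix, Cryptography.QCircuit.toMatrix, Matrix.transpose_list_prod,
    List.map_reverse, List.reverse_reverse, List.map_reverse, List.reverse_reverse]
  simp only [List.map_map]
  congr 1
  refine List.map_congr_left fun i _ => ?_
  simp only [Function.comp_apply]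
  exact (hOn_toMatrix_transpose i).symm

/-- **Rows of the reversed layer at labels vanishing on `ws`.** [cite: NielsenChuang2010, §1.4.4] -/
theorem hadLayerRev_apply_of_zero {ws : List (Fin N)} (hws : ws.Nodup) {x : Cryptography.QReg N}
    (hx : ∀ i ∈ ws, x i = false) (y : Cryptography.QReg N) :
    hadLayerRev ws x y = if EqOff ws y x then invSqrt2 ^ ws.length else 0 := by
  rw [hadLayerRev_eq_transpose, Matrix.transpose_apply, hadLayer_apply_of_zero hws hx]

/-- `(1/√2)^a (1/√2)^a = 2^{-a}`. [folklore] -/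
theorem invSqrt2_pow_mul_invSqrt2_pow (a : ℕ) : invSqrt2 ^ a * invSqrt2 ^ a = ((1 / 2 : ℝ) : ℂ) ^ a := by
  rw [← mul_pow, invSqrt2_mul_invSqrt2]
  norm_num

/-- **The Hadamard sandwich formula.** For distinct wires `ws` and labels `x`, `z` vanishing on `ws`,
the `(x, z)` entry of `H^{ws}_rev · M · H^{ws}` is the average `2^{-|ws|} Σ_{y' ∼ x} Σ_{y ∼ z} M y' y`
over the fibres (the `|0⟩`-block of a PREPARE–SELECT–PREPARE† sandwich with uniform PREPARE).
[cite: BerryEtAl2014, §3 and Lemma 3.1] -/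
theorem hadSandwich_apply {ws : List (Fin N)} (hws : ws.Nodup) (M : Matrix (Cryptography.QReg N) (Cryptography.QReg N) ℂ)
    {x z : Cryptography.QReg N} (hx : ∀ i ∈ ws, x i = false) (hz : ∀ i ∈ ws, z i = false) :
    (hadLayerRev ws * M * hadLayer ws) x z =
      ((1 / 2 : ℝ) : ℂ) ^ ws.length * ∑ y' ∈ fibreOff ws x, ∑ y ∈ fibreOff ws z, M y' y := by
  set c : ℂ := invSqrt2 ^ ws.length with hc
  have hL : ∀ y, hadLayer ws y z = if y ∈ fibreOff ws z then c else 0 := fun y => by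
    rw [hadLayer_apply_of_zero hws hz]
    by_cases h : EqOff ws y z
    · rw [if_pos h, if_pos (mem_fibreOff.2 h)]
    · rw [if_neg h, if_neg (fun h' => h (mem_fibreOff.1 h'))]
  have hR : ∀ y', hadLayerRev ws x y' = if y' ∈ fibreOff ws x then c else 0 := fun y' => by
    rw [hadLayerRev_apply_of_zero hws hx]
    by_cases h : EqOff ws y' x
    · rw [if_pos h, if_pos (mem_fibreOff.2 h)]
    · rw [if_neg h, if_neg (fun h' => h (mem_fibreOff.1 h'))]
  have inner : ∀ y, (hadLayerRev ws * M) x y = c * ∑ y' ∈ fibreOff ws x, M y' y := fun y => by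
    rw [Matrix.mul_apply]
    simp_rw [hR, ite_mul, zero_mul]
    rw [Finset.sum_ite_mem, Finset.univ_inter, Finset.mul_sum]
  rw [Matrix.mul_apply]
  simp_rw [inner, hL, mul_ite, mul_zero]
  rw [Finset.sum_ite_mem, Finset.univ_inter, ← invSqrt2_pow_mul_invSqrt2_pow, ← hc, Finset.sum_comm, Finset.mul_sum]
  refine Finset.sum_congr rfl fun y _ => ?_
  rw [Finset.mul_sum, Finset.mul_sum, Finset.sum_mul]
  refine Finset.sum_congr rfl fun y' _ => ?_
  ring

/-! ### The signed-permutation middle operator: `CNOT(c → t) · diag(i^{g})` -/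

/-- The diagonal phase operator `|y⟩ ↦ i^{g(y)} |y⟩` of an integer-valued predicate `g` (realised
over Clifford+`T` by computing `g mod 4` into ancillas, `S`/`Z` gates, and uncomputing).
[cite: NielsenChuang2010, §4.3] -/
def phaseDiag (g : Cryptography.QReg N → ℕ) : Matrix (Cryptography.QReg N) (Cryptography.QReg N) ℂ :=
  Matrix.diagonal fun y => Complex.I ^ g y

/-- Entries of the `CNOT` matrix: `⟨y'| CNOT_{c→t} |y⟩ = [y' = y with bit t flipped iff y c]`.
[cite: NielsenChuang2010, §1.3.2] -/
theorem cnotOn_toMatrix_apply (c t : Fin N) (hct : c ≠ t) (y' y : Cryptography.QReg N) :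
    (cnotOn c t hct).toMatrix 0 y' y = if y' = Function.update y t (y t ^^ y c) then 1 else 0 := by
  have h := cnotOn_mulVec_basisState 0 c t hct y
  rw [mulVec_basisState] at h
  have := congrFun h y'
  rw [this, Cryptography.basisState_apply]

/-- Entries of the middle operator `CNOT_{c→t} · diag(i^g)`. [folklore] -/
theorem cnot_mul_phaseDiag_apply (c t : Fin N) (hct : c ≠ t) (g : Cryptography.QReg N → ℕ) (y' y : Cryptography.QReg N) :
    ((cnotOn c t hct).toMatrix 0 * phaseDiag g) y' y =
      if y' = Function.update y t (y t ^^ y c) then Complex.I ^ g y else 0 := by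
  rw [phaseDiag, Matrix.mul_diagonal, cnotOn_toMatrix_apply]
  split_ifs <;> simp

/-- **The block of the sign-averaging gadget.** Let `ws` be distinct ancilla wires (in applications
containing the *column wire* `c`), let `t ∉ ws` be the target wire, and `g` an integer predicate. For labels `x`, `z`
vanishing on `ws`, the `(x, z)` entry of `H^{ws}_rev · CNOT_{c→t} · diag(i^g) · H^{ws}` vanishes unless
`x` and `z` agree off `t` (and `ws`), and then equals `2^{-|ws|} Σ i^{g(y)}` over the labels `y` that
agree with `z` off `ws` and carry `y c = x t ⊕ z t`: a `2 × 2` block in the bit `t` whose entries are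
dyadic averages of fourth roots of unity. [cite: BerryEtAl2014, §3 and Lemma 3.1] -/
theorem hadSandwich_cnot_phase_apply {ws : List (Fin N)} (hws : ws.Nodup) {c t : Fin N} (ht : t ∉ ws)
    (hct : c ≠ t) (g : Cryptography.QReg N → ℕ) {x z : Cryptography.QReg N} (hx : ∀ i ∈ ws, x i = false)
    (hz : ∀ i ∈ ws, z i = false) :
    (hadLayerRev ws * ((cnotOn c t hct).toMatrix 0 * phaseDiag g) * hadLayer ws) x z =
      if EqOff (t :: ws) z x then
        ((1 / 2 : ℝ) : ℂ) ^ ws.length * ∑ y ∈ (fibreOff ws z).filter (fun y => y c = (x t ^^ z t)), Complex.I ^ g y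
      else 0 := by
  rw [hadSandwich_apply hws _ hx hz]
  simp_rw [cnot_mul_phaseDiag_apply]
  -- the inner sum over `y' ∈ fibre x` picks out `y' = cx(y)` when that label lies in the fibre
  have inner : ∀ y ∈ fibreOff ws z, (∑ y' ∈ fibreOff ws x, if y' = Function.update y t (y t ^^ y c) then Complex.I ^ g y else 0) =
      if EqOff (t :: ws) z x ∧ y c = (x t ^^ z t) then Complex.I ^ g y else 0 := by
    intro y hy
    rw [mem_fibreOff] at hy
    rw [Finset.sum_ite_eq' (fibreOff ws x) (Function.update y t (y t ^^ y c)) (fun _ => Complex.I ^ g y)]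
    have hzt : y t = z t := hy t ht
    have key : Function.update y t (y t ^^ y c) ∈ fibreOff ws x ↔ EqOff (t :: ws) z x ∧ y c = (x t ^^ z t) := by
      rw [mem_fibreOff]
      constructor
      · intro h
        have h1 := h t ht
        rw [Function.update_self, hzt] at h1
        refine ⟨fun j hj => ?_, ?_⟩
        · simp only [List.mem_cons, not_or] at hj
          have := h j hj.2
          rw [Function.update_of_ne hj.1] at this
          rw [← hy j hj.2, this]
        · rw [← h1]; cases z t <;> cases y c <;> rfl
      · rintro ⟨h, h2⟩ j hj
        by_cases hjt : j = t
        · subst hjt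
          rw [Function.update_self, hzt, h2]
          cases x j <;> cases z j <;> rfl
        · rw [Function.update_of_ne hjt, hy j hj]
          exact h j (by simp [hjt, hj])
    by_cases h : EqOff (t :: ws) z x ∧ y c = (x t ^^ z t)
    · rw [if_pos (key.2 h), if_pos h]
    · rw [if_neg (fun h' => h (key.1 h')), if_neg h]
  rw [Finset.sum_comm, Finset.sum_congr rfl inner]
  by_cases hA : EqOff (t :: ws) z x
  · simp only [hA, true_and, if_true]
    rw [Finset.sum_filter]
  · simp only [hA, false_and, if_false, Finset.sum_const_zero, mul_zero]

/-! ### A norm bound for wire-local operators -/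

/-- **Wire-local operators with small entries have small norm.** If `K x z = 0` unless `x` and `z`
agree off the distinct wires `T` (`|T| = m`), and every entry has modulus `≤ η`, then
`‖Kψ‖₂ ≤ 2^m η ‖ψ‖₂` for every `ψ` (Cauchy–Schwarz on each fibre, and every label lies in `2^m`
fibres). [folklore] -/
theorem l2Norm_mulVec_le_of_local {T : List (Fin N)} (hT : T.Nodup) {K : Matrix (Cryptography.QReg N) (Cryptography.QReg N) ℂ}
    {η : ℝ} (hη : 0 ≤ η) (hloc : ∀ x z, ¬ EqOff T x z → K x z = 0) (hbd : ∀ x z, ‖K x z‖ ≤ η)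
    (ψ : Cryptography.QReg N → ℂ) :
    l2Norm (K *ᵥ ψ) ≤ 2 ^ T.length * η * l2Norm ψ := by
  have hm : (0 : ℝ) ≤ 2 ^ T.length := by positivity
  refine l2Norm_le_of_normSq_le (mul_nonneg (mul_nonneg hm hη) (l2Norm_nonneg ψ)) ?_
  rw [mul_pow, mul_pow, l2Norm_sq]
  -- pointwise Cauchy–Schwarz on the fibre of `x`
  have hpt : ∀ x, ‖(K *ᵥ ψ) x‖ ^ 2 ≤ η ^ 2 * 2 ^ T.length * ∑ z ∈ fibreOff T x, ‖ψ z‖ ^ 2 := by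
    intro x
    have e1 : (K *ᵥ ψ) x = ∑ z ∈ fibreOff T x, K x z * ψ z := by
      rw [Matrix.mulVec, dotProduct, fibreOff, Finset.sum_filter]
      refine Finset.sum_congr rfl fun z _ => ?_
      by_cases h : EqOff T z x
      · rw [if_pos h]
      · rw [if_neg h, hloc x z fun h' => h h'.symm, zero_mul]
    rw [e1]
    have h1 : ‖∑ z ∈ fibreOff T x, K x z * ψ z‖ ≤ ∑ z ∈ fibreOff T x, η * ‖ψ z‖ :=
      (norm_sum_le _ _).trans (Finset.sum_le_sum fun z _ => by
        rw [norm_mul]; exact mul_le_mul_of_nonneg_right (hbd x z) (norm_nonneg _))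
    have h2 : (∑ z ∈ fibreOff T x, η * ‖ψ z‖) ^ 2 ≤ (fibreOff T x).card * ∑ z ∈ fibreOff T x, (η * ‖ψ z‖) ^ 2 :=
      sq_sum_le_card_mul_sum_sq
    rw [card_fibreOff hT x] at h2
    calc ‖∑ z ∈ fibreOff T x, K x z * ψ z‖ ^ 2 ≤ (∑ z ∈ fibreOff T x, η * ‖ψ z‖) ^ 2 :=
          pow_le_pow_left₀ (norm_nonneg _) h1 2
      _ ≤ ((2 ^ T.length : ℕ) : ℝ) * ∑ z ∈ fibreOff T x, (η * ‖ψ z‖) ^ 2 := h2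
      _ = η ^ 2 * 2 ^ T.length * ∑ z ∈ fibreOff T x, ‖ψ z‖ ^ 2 := by
          rw [Finset.mul_sum, Finset.mul_sum]
          refine Finset.sum_congr rfl fun z _ => ?_
          push_cast; ring
  -- sum over `x` and swap
  calc Cryptography.normSq (K *ᵥ ψ) = ∑ x, ‖(K *ᵥ ψ) x‖ ^ 2 := rfl
    _ ≤ ∑ x, η ^ 2 * 2 ^ T.length * ∑ z ∈ fibreOff T x, ‖ψ z‖ ^ 2 := Finset.sum_le_sum fun x _ => hpt x
    _ = η ^ 2 * 2 ^ T.length * ∑ x, ∑ z ∈ fibreOff T x, ‖ψ z‖ ^ 2 := by rw [Finset.mul_sum]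
    _ = η ^ 2 * 2 ^ T.length * (2 ^ T.length * Cryptography.normSq ψ) := by
        congr 1
        -- `Σ_x Σ_{z ∼ x} f z = Σ_z f z · #{x ∼ z} = 2^m Σ_z f z`
        have hswap : ∑ x, ∑ z ∈ fibreOff T x, ‖ψ z‖ ^ 2 = ∑ z, ∑ x ∈ fibreOff T z, ‖ψ z‖ ^ 2 := by
          simp only [fibreOff, Finset.sum_filter]
          rw [Finset.sum_comm]
          refine Finset.sum_congr rfl fun z _ => Finset.sum_congr rfl fun x _ => ?_
          simp only [eqOff_comm]
        rw [hswap, Cryptography.normSq, Finset.mul_sum]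
        refine Finset.sum_congr rfl fun z _ => ?_
        rw [Finset.sum_const, card_fibreOff hT z, nsmul_eq_mul]
        push_cast; ring
    _ = (2 ^ T.length) ^ 2 * η ^ 2 * Cryptography.normSq ψ := by ring

end Literature.Computability.QuantumComplexity

end
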